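import Literature.MathematicalPhysics.QuantumFieldTheory.Balaban1983to89.B9Thm310CommutatorDataOfPlaquettes
import Literature.MathematicalPhysics.QuantumFieldTheory.Balaban1983to89.B9Eq335PlaquetteAtLettersY
import HarnessLib

/-!
# Route `UnitScaleTilt`, crux K1 «MinimiserStabilityRegPr» (stmt-QuantumFields-19200), route-R E′ path (α′), (E1-b) covariant, (N-cov) near field — «CONE ROWS», FILE A:
# THE ORDERED-POWER REGAUGE, PURE ALGEBRA — `P(w) := ∏_{i<d} k_i^{w_i}` (ordered, `zpow` in a group) satisfies `P(w + e_ν) = P(w)·k̃_ν(w)` with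
# `k̃_ν(w) := B_ν(w)⁻¹·k_ν·B_ν(w)`, `B_ν(w) := ∏_{i>ν} k_i^{w_i}`, and in a normed ring `‖k̃_ν(w) − k_ν‖ ≤ 2τ₁²·|w|₁`, `‖k̃_ν(w + e_μ) − k̃_ν(w)‖ ≤ 2τ₁²`

Cell `ym3-torus`, extra width seat `ym-routeR-w4` (g10); ★routeR-w3 g6 NAMER WORD (11) 2026-08-28T22:14Z «routeR-w4 g10: CONE ROWS — GO» on ym-routeR-w6 g6's spec
(22:12:41Z): remove the CONSTANT TILT `k_μ := h_μ(y₀)` of a (3.35) ball frame by the ordered-power regauge so that the regauged links grow LINEARLY from the pole,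
`‖h′_μ(x) − 1‖ ≲ τ₂·dist₁(x, y₀)`, the price being commutators `‖[k_μ, k_ν]‖ ≤ 2τ₁²` per swap.  This file is the torus-free group∕commutator algebra; FILE B (`…Prop7ConeRegaugeRows`) adds
the two row algebras and puts them on `Site P j` with ✓ `B10Eq27TorusAxialLog.rel`; FILE C (`…Prop7ConeRegauge`) is the member corollary over ✓ `Prop7MemberBallFrames.exists_ballFrame_of_regPr` (px4 g3, p672574).  THEOREMS ONLY
(0 `def`, 0 `sorry`); `--supports stmt-QuantumFields-19200`, count-neutral.  YM₃ on T³ is a ladder rung (R3), not the Clay problem; nothing here claims a stub, the crux,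
d = 4 or the mass gap.

WHAT IS PROVED (ns `…Theorems.Prop7ConeRegaugeAlgebra`; the ordered product is written out as `(List.ofFn fun i => k i ^ w i).prod`, its tail beyond `ν` as
`(List.ofFn fun i => if ν < i then k i ^ w i else 1).prod` — no `def`).
* §1 (any group `G`, any `d`) `prod_ofFn_zpow_zero` (`P(0) = 1`); ★★ `prod_ofFn_zpow_add_single` (`P(w + e_ν) = P(w)·(B_ν(w)⁻¹·k_ν·B_ν(w))`, induction on `d`);
  ★ `tailProd_add_single_of_lt` (`B_ν(w + e_μ) = B_ν(w)·(B_μ(w)⁻¹·k_μ·B_μ(w))` for `ν < μ`: the same identity for the family `[ν < i]·k_i`); `tailProd_add_single_of_le`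
  (`B_ν(w + e_μ) = B_ν(w)` for `μ ≤ ν`).
* §2 (normed ring, `‖1‖ = 1`; `‖ab − ba‖ ≤ 2‖a − 1‖‖b − 1‖` is ✓ `B9Eq335Plaquette.norm_comm_le`) `norm_comm_mul_le`; `norm_list_prod_le_one`; `norm_comm_list_prod_le` (`‖[a, ∏f_j]‖ ≤ Σ‖[a, f_j]‖`
  for contractions `f_j`); `bicontr_pow` ∕ `bicontr_zpow` ∕ `bicontr_list_prod`; ★ `norm_comm_zpow_le` (`‖[a, u^m]‖ ≤ |m|·‖[a, u]‖` for bi-contractive `u`).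
* §3 ★★ `norm_conjTail_sub_le` — `‖k̃_ν(w) − k_ν‖ ≤ 2τ₁²·Σ_i|w_i|` for bi-contractive `k_i` with `‖k_i − 1‖ ≤ τ₁`; `norm_conjTail_sub_one_le` (`‖k̃_ν(w) − 1‖ ≤ τ₁`);
  ★ `norm_conj_sub_conj_le_comm` (`‖m⁻¹km − k‖ ≤ 2‖k − 1‖‖m − 1‖` — the `k̃∕k̂` swap).
(The two ROW ALGEBRAS — size `‖P·H·P′⁻¹ − 1‖ ≤ δ + ε` and the difference row — and the torus rows are FILE B `…Prop7ConeRegaugeRows`; the member corollary is FILE C.)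
HONEST SCOPE.  [folklore] group and normed-ring bookkeeping; no analytic content, no lattice.

References: T. Bałaban, CMP 99 (1985) 389–434 [Balaban1985BackgroundPropagators] ((3.28) p.395 (gauge-transformed bond variables), (3.35) p.396); CMP 102 (1985) 255–275
[Balaban1985UV3] ((27) p.263, the axial∕comb gauge which this regauge refines at one point).
-/

set_option autoImplicit false

namespace Summit.QuantumFields.YangMills.Theorems.Prop7ConeRegaugeAlgebra

open Literature.MathematicalPhysics.QuantumFieldTheory.Balaban1983to89
open B9Thm310CommutatorDataOfPlaquettes (bicontr_mul bicontr_inv)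
open B9Eq335PlaquetteAtLettersY (norm_conj_sub_one_le)
open B9Eq335Plaquette (norm_comm_le)

/-! ## §1 The ordered product `P(w) = ∏ k_i^{w_i}` and its one-step recursion (any group) -/

section GroupLevel

variable {G : Type*} [Group G]

/-- `P(0) = 1`. [folklore] -/
theorem prod_ofFn_zpow_zero (n : ℕ) (k : Fin n → G) :
    (List.ofFn fun i => k i ^ (0 : Fin n → ℤ) i).prod = 1 := by
  simp [List.ofFn_const]

/-- ★★ **THE ONE-STEP RECURSION OF THE ORDERED PRODUCT**: `P(w + e_ν) = P(w)·(B_ν(w)⁻¹·k_ν·B_ν(w))`, `B_ν(w) = ∏_{i>ν} k_i^{w_i}` (ordered) — inserting one more `k_ν`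
in the middle of the ordered product costs a conjugation by the tail. [folklore] -/
theorem prod_ofFn_zpow_add_single : ∀ (n : ℕ) (k : Fin n → G) (w : Fin n → ℤ) (ν : Fin n),
    (List.ofFn fun i => k i ^ (w + Pi.single ν 1 : Fin n → ℤ) i).prod =
      (List.ofFn fun i => k i ^ w i).prod *
        (((List.ofFn fun i => if ν < i then k i ^ w i else 1).prod)⁻¹ * k ν *
          (List.ofFn fun i => if ν < i then k i ^ w i else 1).prod)
  | 0, _, _, ν => ν.elim0
  | n + 1, k, w, ν => by
    induction ν using Fin.cases with
    | zero =>
      have e1 : (fun i : Fin (n + 1) => k i ^ (w + Pi.single (0 : Fin (n + 1)) 1 : Fin (n + 1) → ℤ) i)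
          = Fin.cons (k 0 ^ (w 0 + 1)) (fun i : Fin n => k i.succ ^ w i.succ) := by
        funext i
        refine Fin.cases ?_ (fun j => ?_) i
        · simp
        · simp
      have e2 : (fun i : Fin (n + 1) => k i ^ w i) = Fin.cons (k 0 ^ w 0) (fun i : Fin n => k i.succ ^ w i.succ) := by
        funext i
        refine Fin.cases ?_ (fun j => ?_) i <;> simp
      have e3 : (fun i : Fin (n + 1) => if (0 : Fin (n + 1)) < i then k i ^ w i else 1)
          = Fin.cons 1 (fun i : Fin n => k i.succ ^ w i.succ) := by
        funext i
        refine Fin.cases ?_ (fun j => ?_) i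
        · simp
        · simp [Fin.succ_pos]
      rw [e1, e2, e3, List.ofFn_cons, List.ofFn_cons, List.ofFn_cons, List.prod_cons, List.prod_cons, List.prod_cons, one_mul,
        zpow_add_one]
      simp only [mul_assoc, mul_inv_cancel_left]
    | succ ν' =>
      have IH := prod_ofFn_zpow_add_single n (fun i => k i.succ) (fun i => w i.succ) ν'
      have e1 : (fun i : Fin (n + 1) => k i ^ (w + Pi.single ν'.succ 1 : Fin (n + 1) → ℤ) i)
          = Fin.cons (k 0 ^ w 0) (fun i : Fin n => k i.succ ^ ((fun j : Fin n => w j.succ) + Pi.single ν' 1 : Fin n → ℤ) i) := by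
        funext i
        refine Fin.cases ?_ (fun j => ?_) i
        · simp
        · simp [Pi.single_apply]
      have e2 : (fun i : Fin (n + 1) => k i ^ w i) = Fin.cons (k 0 ^ w 0) (fun i : Fin n => k i.succ ^ w i.succ) := by
        funext i
        refine Fin.cases ?_ (fun j => ?_) i <;> simp
      have e3 : (fun i : Fin (n + 1) => if ν'.succ < i then k i ^ w i else 1)
          = Fin.cons 1 (fun i : Fin n => if ν' < i then k i.succ ^ w i.succ else 1) := by
        funext i
        refine Fin.cases ?_ (fun j => ?_) i
        · simp
        · simp [Fin.succ_lt_succ_iff]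
      rw [e1, e2, e3, List.ofFn_cons, List.ofFn_cons, List.ofFn_cons, List.prod_cons, List.prod_cons, List.prod_cons, one_mul, IH]
      simp only [mul_assoc]

/-- pushing `zpow` through the indicator: `([ν < i]·k_i)^{v_i} = [ν < i]·k_i^{v_i}`. [folklore] -/
theorem ite_zpow_eq (n : ℕ) (k : Fin n → G) (ν : Fin n) (v : Fin n → ℤ) :
    (fun i => (if ν < i then k i else 1) ^ v i) = fun i => if ν < i then k i ^ v i else 1 := by funext i; split_ifs <;> simp

/-- ★ **THE TAIL'S RECURSION** (`ν < μ`): `B_ν(w + e_μ) = B_ν(w)·(B_μ(w)⁻¹·k_μ·B_μ(w))` — ✓ `prod_ofFn_zpow_add_single` for the family `[ν < i]·k_i`. [folklore] -/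
theorem tailProd_add_single_of_lt (n : ℕ) (k : Fin n → G) (w : Fin n → ℤ) {ν μ : Fin n} (hνμ : ν < μ) :
    (List.ofFn fun i => if ν < i then k i ^ (w + Pi.single μ 1 : Fin n → ℤ) i else 1).prod =
      (List.ofFn fun i => if ν < i then k i ^ w i else 1).prod *
        (((List.ofFn fun i => if μ < i then k i ^ w i else 1).prod)⁻¹ * k μ *
          (List.ofFn fun i => if μ < i then k i ^ w i else 1).prod) := by
  have h := prod_ofFn_zpow_add_single n (fun i => if ν < i then k i else 1) w μ
  have e' : (fun i => if μ < i then (if ν < i then k i else 1) ^ w i else 1) = fun i => if μ < i then k i ^ w i else 1 := by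
    funext i
    by_cases hi : μ < i
    · have hνi : ν < i := hνμ.trans hi
      simp [hi, hνi]
    · simp [hi]
  rw [ite_zpow_eq, ite_zpow_eq, e', if_pos hνμ] at h
  exact h

/-- The tail beyond `ν` does not see a step in a direction `μ ≤ ν`: `B_ν(w + e_μ) = B_ν(w)`. [folklore] -/
theorem tailProd_add_single_of_le (n : ℕ) (k : Fin n → G) (w : Fin n → ℤ) {ν μ : Fin n} (hμν : μ ≤ ν) :
    (List.ofFn fun i => if ν < i then k i ^ (w + Pi.single μ 1 : Fin n → ℤ) i else 1).prod =
      (List.ofFn fun i => if ν < i then k i ^ w i else 1).prod := by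
  have e : (fun i => if ν < i then k i ^ (w + Pi.single μ 1 : Fin n → ℤ) i else 1) = fun i => if ν < i then k i ^ w i else 1 := by
    funext i
    by_cases hi : ν < i
    · have hne : i ≠ μ := ne_of_gt (lt_of_le_of_lt hμν hi)
      simp [hi, Pi.single_eq_of_ne hne]
    · simp [hi]
  rw [e]

end GroupLevel

/-! ## §2 Commutator bookkeeping in a normed ring -/

section NormLevel

variable {𝔸 : Type} [NormedRing 𝔸] [NormOneClass 𝔸]

omit [NormOneClass 𝔸] in
/-- `‖[a, fg]‖ ≤ ‖[a,f]‖ + ‖[a,g]‖` for contractions `f, g`. [folklore] -/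
theorem norm_comm_mul_le (a f g : 𝔸) (hf : ‖f‖ ≤ 1) (hg : ‖g‖ ≤ 1) :
    ‖a * (f * g) - f * g * a‖ ≤ ‖a * f - f * a‖ + ‖a * g - g * a‖ := by
  have e : a * (f * g) - f * g * a = (a * f - f * a) * g + f * (a * g - g * a) := by noncomm_ring
  rw [e]
  calc _ ≤ ‖(a * f - f * a) * g‖ + ‖f * (a * g - g * a)‖ := norm_add_le _ _
    _ ≤ ‖a * f - f * a‖ * ‖g‖ + ‖f‖ * ‖a * g - g * a‖ := add_le_add (norm_mul_le _ _) (norm_mul_le _ _)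
    _ ≤ ‖a * f - f * a‖ * 1 + 1 * ‖a * g - g * a‖ := by gcongr
    _ = _ := by ring

/-- a product of contractions is a contraction. [folklore] -/
theorem norm_list_prod_le_one : ∀ (L : List 𝔸), (∀ f ∈ L, ‖f‖ ≤ 1) → ‖L.prod‖ ≤ 1
  | [], _ => by simp
  | f :: L, h => by
    rw [List.prod_cons]
    have hf : ‖f‖ ≤ 1 := h f (by simp)
    have hL : ‖L.prod‖ ≤ 1 := norm_list_prod_le_one L fun g hg => h g (by simp [hg])
    exact (norm_mul_le _ _).trans (mul_le_one₀ hf (norm_nonneg _) hL)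

/-- `‖[a, ∏_j f_j]‖ ≤ Σ_j ‖[a, f_j]‖` for a list of contractions. [folklore] -/
theorem norm_comm_list_prod_le (a : 𝔸) : ∀ (L : List 𝔸), (∀ f ∈ L, ‖f‖ ≤ 1) →
    ‖a * L.prod - L.prod * a‖ ≤ (L.map fun f => ‖a * f - f * a‖).sum
  | [], _ => by simp
  | f :: L, h => by
    rw [List.prod_cons, List.map_cons, List.sum_cons]
    have hf : ‖f‖ ≤ 1 := h f (by simp)
    have hL' : ∀ g ∈ L, ‖g‖ ≤ 1 := fun g hg => h g (by simp [hg])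
    exact (norm_comm_mul_le a f L.prod hf (norm_list_prod_le_one L hL')).trans (by gcongr; exact norm_comm_list_prod_le a L hL')

/-- powers of a bi-contractive unit are bi-contractive. [cite: Balaban1985BackgroundPropagators, (3.1) p.390, bookkeeping] -/
theorem bicontr_pow {u : 𝔸ˣ} (hu : ‖(u : 𝔸)‖ ≤ 1 ∧ ‖((u⁻¹ : 𝔸ˣ) : 𝔸)‖ ≤ 1) : ∀ n : ℕ,
    ‖((u ^ n : 𝔸ˣ) : 𝔸)‖ ≤ 1 ∧ ‖(((u ^ n)⁻¹ : 𝔸ˣ) : 𝔸)‖ ≤ 1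
  | 0 => by simp
  | n + 1 => by rw [pow_succ]; exact bicontr_mul (bicontr_pow hu n) hu

/-- integer powers of a bi-contractive unit are bi-contractive. [cite: Balaban1985BackgroundPropagators, (3.1) p.390, bookkeeping] -/
theorem bicontr_zpow {u : 𝔸ˣ} (hu : ‖(u : 𝔸)‖ ≤ 1 ∧ ‖((u⁻¹ : 𝔸ˣ) : 𝔸)‖ ≤ 1) : ∀ m : ℤ,
    ‖((u ^ m : 𝔸ˣ) : 𝔸)‖ ≤ 1 ∧ ‖(((u ^ m)⁻¹ : 𝔸ˣ) : 𝔸)‖ ≤ 1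
  | (n : ℕ) => by rw [zpow_natCast]; exact bicontr_pow hu n
  | Int.negSucc n => by rw [zpow_negSucc]; exact bicontr_inv (bicontr_pow hu (n + 1))

/-- a list product of bi-contractive units is bi-contractive. [cite: Balaban1985BackgroundPropagators, (3.1) p.390, bookkeeping] -/
theorem bicontr_list_prod : ∀ (L : List 𝔸ˣ), (∀ u ∈ L, ‖(u : 𝔸)‖ ≤ 1 ∧ ‖((u⁻¹ : 𝔸ˣ) : 𝔸)‖ ≤ 1) →
    ‖((L.prod : 𝔸ˣ) : 𝔸)‖ ≤ 1 ∧ ‖(((L.prod)⁻¹ : 𝔸ˣ) : 𝔸)‖ ≤ 1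
  | [], _ => by simp
  | u :: L, h => by
    rw [List.prod_cons]
    exact bicontr_mul (h u (by simp)) (bicontr_list_prod L fun v hv => h v (by simp [hv]))

omit [NormOneClass 𝔸] in
/-- `‖[a, u⁻¹]‖ ≤ ‖[a, u]‖` for a bi-contractive unit (`[a, u⁻¹] = −u⁻¹[a,u]u⁻¹`). [folklore] -/
theorem norm_comm_inv_le (a : 𝔸) {u : 𝔸ˣ} (hu : ‖(u : 𝔸)‖ ≤ 1 ∧ ‖((u⁻¹ : 𝔸ˣ) : 𝔸)‖ ≤ 1) :
    ‖a * ((u⁻¹ : 𝔸ˣ) : 𝔸) - ((u⁻¹ : 𝔸ˣ) : 𝔸) * a‖ ≤ ‖a * u - u * a‖ := by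
  have e : a * ((u⁻¹ : 𝔸ˣ) : 𝔸) - ((u⁻¹ : 𝔸ˣ) : 𝔸) * a = -(((u⁻¹ : 𝔸ˣ) : 𝔸) * (a * u - u * a) * ((u⁻¹ : 𝔸ˣ) : 𝔸)) := by
    rw [mul_sub, sub_mul, mul_assoc, mul_assoc, Units.mul_inv, mul_one, ← mul_assoc _ (u : 𝔸), Units.inv_mul, one_mul]
    abel
  rw [e, norm_neg]
  calc _ ≤ ‖((u⁻¹ : 𝔸ˣ) : 𝔸) * (a * u - u * a)‖ * ‖((u⁻¹ : 𝔸ˣ) : 𝔸)‖ := norm_mul_le _ _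
    _ ≤ (‖((u⁻¹ : 𝔸ˣ) : 𝔸)‖ * ‖a * u - u * a‖) * 1 := by gcongr; exacts [norm_mul_le _ _, hu.2]
    _ ≤ (1 * ‖a * u - u * a‖) * 1 := by gcongr; exact hu.2
    _ = _ := by ring

/-- `‖[a, u^n]‖ ≤ n·‖[a, u]‖` for a bi-contractive unit. [folklore] -/
theorem norm_comm_pow_le (a : 𝔸) {u : 𝔸ˣ} (hu : ‖(u : 𝔸)‖ ≤ 1 ∧ ‖((u⁻¹ : 𝔸ˣ) : 𝔸)‖ ≤ 1) : ∀ n : ℕ,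
    ‖a * ((u ^ n : 𝔸ˣ) : 𝔸) - ((u ^ n : 𝔸ˣ) : 𝔸) * a‖ ≤ (n : ℝ) * ‖a * u - u * a‖
  | 0 => by simp
  | n + 1 => by
    rw [pow_succ, Units.val_mul]
    calc _ ≤ ‖a * ((u ^ n : 𝔸ˣ) : 𝔸) - ((u ^ n : 𝔸ˣ) : 𝔸) * a‖ + ‖a * u - u * a‖ :=
          norm_comm_mul_le a _ _ (bicontr_pow hu n).1 hu.1
      _ ≤ (n : ℝ) * ‖a * u - u * a‖ + ‖a * u - u * a‖ := by gcongr; exact norm_comm_pow_le a hu n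
      _ = ((n + 1 : ℕ) : ℝ) * ‖a * u - u * a‖ := by push_cast; ring

/-- ★ `‖[a, u^m]‖ ≤ |m|·‖[a, u]‖` for a bi-contractive unit and `m ∈ ℤ`. [folklore] -/
theorem norm_comm_zpow_le (a : 𝔸) {u : 𝔸ˣ} (hu : ‖(u : 𝔸)‖ ≤ 1 ∧ ‖((u⁻¹ : 𝔸ˣ) : 𝔸)‖ ≤ 1) : ∀ m : ℤ,
    ‖a * ((u ^ m : 𝔸ˣ) : 𝔸) - ((u ^ m : 𝔸ˣ) : 𝔸) * a‖ ≤ (m.natAbs : ℝ) * ‖a * u - u * a‖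
  | (n : ℕ) => by rw [zpow_natCast, Int.natAbs_natCast]; exact norm_comm_pow_le a hu n
  | Int.negSucc n => by
    rw [zpow_negSucc, ← inv_pow, Int.natAbs_negSucc]
    exact (norm_comm_pow_le a (bicontr_inv hu) (n + 1)).trans
      (mul_le_mul_of_nonneg_left (norm_comm_inv_le a hu) (Nat.cast_nonneg _))

/-! ## §3 The conjugated tilt `k̃_ν(w) = B_ν(w)⁻¹ k_ν B_ν(w)` is `2τ₁²|w|₁`-close to `k_ν` -/

omit [NormOneClass 𝔸] in
/-- the coercion of a list product of units is the list product of the coercions. [folklore] -/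
theorem val_list_prod (L : List 𝔸ˣ) : (((L.prod : 𝔸ˣ)) : 𝔸) = (L.map (fun u : 𝔸ˣ => (u : 𝔸))).prod :=
  map_list_prod (Units.coeHom 𝔸) L

/-- ★★ **THE TILT COMMUTES WITH THE TAIL UP TO `2τ₁²` PER UNIT OF LENGTH**: for bi-contractive `k_i` with `‖k_i − 1‖ ≤ τ₁`:
`‖B_ν(w)⁻¹·k_ν·B_ν(w) − k_ν‖ ≤ 2τ₁²·Σ_i |w_i|`. [cite: Balaban1985BackgroundPropagators, (3.10) p.392, (3.35) p.396, bookkeeping] -/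
theorem norm_conjTail_sub_le {n : ℕ} (k : Fin n → 𝔸ˣ) (hk : ∀ i, ‖(k i : 𝔸)‖ ≤ 1 ∧ ‖(((k i)⁻¹ : 𝔸ˣ) : 𝔸)‖ ≤ 1) {τ₁ : ℝ}
    (hk1 : ∀ i, ‖(k i : 𝔸) - 1‖ ≤ τ₁) (w : Fin n → ℤ) (ν : Fin n) :
    ‖((((List.ofFn fun i => if ν < i then k i ^ w i else 1).prod)⁻¹ * k ν *
          (List.ofFn fun i => if ν < i then k i ^ w i else 1).prod : 𝔸ˣ) : 𝔸) - k ν‖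
      ≤ 2 * τ₁ ^ 2 * ∑ i, ((w i).natAbs : ℝ) := by
  set L : List 𝔸ˣ := List.ofFn fun i => if ν < i then k i ^ w i else 1 with hL
  have hfac : ∀ i : Fin n, ‖(((if ν < i then k i ^ w i else 1 : 𝔸ˣ)) : 𝔸)‖ ≤ 1 ∧
      ‖((((if ν < i then k i ^ w i else 1 : 𝔸ˣ))⁻¹ : 𝔸ˣ) : 𝔸)‖ ≤ 1 := by
    intro i; split_ifs
    · exact bicontr_zpow (hk i) (w i)
    · simp
  have hB : ‖((L.prod : 𝔸ˣ) : 𝔸)‖ ≤ 1 ∧ ‖(((L.prod)⁻¹ : 𝔸ˣ) : 𝔸)‖ ≤ 1 :=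
    bicontr_list_prod L fun u hu => by
      rw [hL, List.mem_ofFn] at hu
      obtain ⟨i, rfl⟩ := hu
      exact hfac i
  -- `B⁻¹ k B − k = B⁻¹ (k B − B k)`
  have e : (((L.prod)⁻¹ * k ν * L.prod : 𝔸ˣ) : 𝔸) - k ν = (((L.prod)⁻¹ : 𝔸ˣ) : 𝔸) * ((k ν : 𝔸) * L.prod - (L.prod : 𝔸) * k ν) := by
    rw [Units.val_mul, Units.val_mul, mul_sub, ← mul_assoc, ← mul_assoc, Units.inv_mul, one_mul]
  rw [e]
  calc _ ≤ ‖(((L.prod)⁻¹ : 𝔸ˣ) : 𝔸)‖ * ‖(k ν : 𝔸) * L.prod - (L.prod : 𝔸) * k ν‖ := norm_mul_le _ _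
    _ ≤ 1 * ‖(k ν : 𝔸) * L.prod - (L.prod : 𝔸) * k ν‖ := by gcongr; exact hB.2
    _ = ‖(k ν : 𝔸) * L.prod - (L.prod : 𝔸) * k ν‖ := one_mul _
    _ ≤ ((L.map (fun u : 𝔸ˣ => (u : 𝔸))).map fun f => ‖(k ν : 𝔸) * f - f * k ν‖).sum := by
        rw [val_list_prod]
        refine norm_comm_list_prod_le (k ν : 𝔸) _ fun f hf => ?_
        rw [List.mem_map] at hf
        obtain ⟨u, hu, rfl⟩ := hf
        rw [hL, List.mem_ofFn] at hu
        obtain ⟨i, rfl⟩ := hu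
        exact (hfac i).1
    _ = ∑ i : Fin n, ‖(k ν : 𝔸) * (((if ν < i then k i ^ w i else 1 : 𝔸ˣ)) : 𝔸) - (((if ν < i then k i ^ w i else 1 : 𝔸ˣ)) : 𝔸) * k ν‖ := by
        rw [hL, List.map_ofFn, List.map_ofFn, List.sum_ofFn]; rfl
    _ ≤ ∑ i : Fin n, 2 * τ₁ ^ 2 * ((w i).natAbs : ℝ) := by
        refine Finset.sum_le_sum fun i _ => ?_
        split_ifs with hi
        · calc _ ≤ ((w i).natAbs : ℝ) * ‖(k ν : 𝔸) * k i - (k i : 𝔸) * k ν‖ := norm_comm_zpow_le (k ν : 𝔸) (hk i) (w i)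
            _ ≤ ((w i).natAbs : ℝ) * (2 * ‖(k ν : 𝔸) - 1‖ * ‖(k i : 𝔸) - 1‖) := by gcongr; exact norm_comm_le _ _
            _ ≤ ((w i).natAbs : ℝ) * (2 * τ₁ * τ₁) := by
                have hτ : 0 ≤ τ₁ := (norm_nonneg _).trans (hk1 ν)
                refine mul_le_mul_of_nonneg_left ?_ (Nat.cast_nonneg _)
                exact mul_le_mul (mul_le_mul_of_nonneg_left (hk1 ν) (by norm_num)) (hk1 i) (norm_nonneg _)
                  (mul_nonneg (by norm_num) hτ)
            _ = 2 * τ₁ ^ 2 * ((w i).natAbs : ℝ) := by ring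
        · simp only [Units.val_one, mul_one, one_mul, sub_self, norm_zero]
          positivity
    _ = 2 * τ₁ ^ 2 * ∑ i, ((w i).natAbs : ℝ) := by rw [Finset.mul_sum]

/-- The conjugated tilt is still within `τ₁` of `1`: `‖B⁻¹ k_ν B − 1‖ ≤ ‖k_ν − 1‖` (bi-contractive `B`). [cite: Balaban1985BackgroundPropagators, (3.35) p.396, bookkeeping] -/
theorem norm_conjTail_sub_one_le {n : ℕ} (k : Fin n → 𝔸ˣ) (hk : ∀ i, ‖(k i : 𝔸)‖ ≤ 1 ∧ ‖(((k i)⁻¹ : 𝔸ˣ) : 𝔸)‖ ≤ 1)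
    (w : Fin n → ℤ) (ν : Fin n) :
    ‖((((List.ofFn fun i => if ν < i then k i ^ w i else 1).prod)⁻¹ * k ν *
          (List.ofFn fun i => if ν < i then k i ^ w i else 1).prod : 𝔸ˣ) : 𝔸) - 1‖ ≤ ‖(k ν : 𝔸) - 1‖ := by
  refine norm_conj_sub_one_le (bicontr_list_prod _ fun u hu => ?_) (k ν)
  rw [List.mem_ofFn] at hu
  obtain ⟨i, rfl⟩ := hu
  split_ifs
  · exact bicontr_zpow (hk i) (w i)
  · simp

/-- The tail (hence `P(w)`) is bi-contractive. [cite: Balaban1985BackgroundPropagators, (3.1) p.390, bookkeeping] -/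
theorem bicontr_tailProd {n : ℕ} (k : Fin n → 𝔸ˣ) (hk : ∀ i, ‖(k i : 𝔸)‖ ≤ 1 ∧ ‖(((k i)⁻¹ : 𝔸ˣ) : 𝔸)‖ ≤ 1)
    (w : Fin n → ℤ) (ν : Fin n) :
    ‖(((List.ofFn fun i => if ν < i then k i ^ w i else 1).prod : 𝔸ˣ) : 𝔸)‖ ≤ 1 ∧
      ‖((((List.ofFn fun i => if ν < i then k i ^ w i else 1).prod)⁻¹ : 𝔸ˣ) : 𝔸)‖ ≤ 1 := by
  refine bicontr_list_prod _ fun u hu => ?_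
  rw [List.mem_ofFn] at hu
  obtain ⟨i, rfl⟩ := hu
  split_ifs
  · exact bicontr_zpow (hk i) (w i)
  · simp

/-- `P(w)` is bi-contractive. [cite: Balaban1985BackgroundPropagators, (3.1) p.390, bookkeeping] -/
theorem bicontr_prod_ofFn_zpow {n : ℕ} (k : Fin n → 𝔸ˣ) (hk : ∀ i, ‖(k i : 𝔸)‖ ≤ 1 ∧ ‖(((k i)⁻¹ : 𝔸ˣ) : 𝔸)‖ ≤ 1)
    (w : Fin n → ℤ) :
    ‖(((List.ofFn fun i => k i ^ w i).prod : 𝔸ˣ) : 𝔸)‖ ≤ 1 ∧ ‖((((List.ofFn fun i => k i ^ w i).prod)⁻¹ : 𝔸ˣ) : 𝔸)‖ ≤ 1 := by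
  refine bicontr_list_prod _ fun u hu => ?_
  rw [List.mem_ofFn] at hu
  obtain ⟨i, rfl⟩ := hu
  exact bicontr_zpow (hk i) (w i)

omit [NormOneClass 𝔸] in
/-- ★ **THE `k̃ ∕ k̂` SWAP**: `‖m⁻¹·k·m − k‖ ≤ 2‖k − 1‖·‖m − 1‖` for a bi-contractive unit `m`. [cite: Balaban1985BackgroundPropagators, (3.10) p.392, bookkeeping] -/
theorem norm_conj_sub_conj_le_comm (k : 𝔸) {m : 𝔸ˣ} (hm : ‖(m : 𝔸)‖ ≤ 1 ∧ ‖((m⁻¹ : 𝔸ˣ) : 𝔸)‖ ≤ 1) :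
    ‖((m⁻¹ : 𝔸ˣ) : 𝔸) * k * m - k‖ ≤ 2 * ‖k - 1‖ * ‖(m : 𝔸) - 1‖ := by
  have e : ((m⁻¹ : 𝔸ˣ) : 𝔸) * k * m - k = ((m⁻¹ : 𝔸ˣ) : 𝔸) * (k * m - m * k) := by
    rw [mul_sub, ← mul_assoc, ← mul_assoc, Units.inv_mul, one_mul]
  rw [e]
  calc _ ≤ ‖((m⁻¹ : 𝔸ˣ) : 𝔸)‖ * ‖k * m - m * k‖ := norm_mul_le _ _
    _ ≤ 1 * (2 * ‖k - 1‖ * ‖(m : 𝔸) - 1‖) := by gcongr; exacts [hm.2, norm_comm_le _ _]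
    _ = _ := one_mul _

end NormLevel

end Summit.QuantumFields.YangMills.Theorems.Prop7ConeRegaugeAlgebra
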